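import Summits.CriticalPhenomena.PercolationContinuityZ3.Theorems.Transplant.SkelNegParamsLattice
import HarnessLib

/-!
# N1 params, part 0e (q-free arithmetic): THE FINE MULTIPLIERS `m₀, m₁` of hp-8 g33's two-unit cells `⟨Kcell, m⟩` (KIT-FRAMES-N1 (R3)):
# `m_i := ⌊D / (20K · L_i)⌋` with `L₀ = 800(|v_β| + |v_α|)`, `L₁ = 800(n + |h|)`, so that the per-axis resolution `c_i := 20K·m_i` satisfies `c_i·L_i ≤ D` BY DEFINITION,
# and the ledger floors give `s ≤ m_i` for every `s` with `K·s + 2 ≤ M_L` (axis 1) / `4K·s + 2 ≤ M_L` (axis 0) — in particular `m_i ≥ 2` (quasi-step exit frames) and `10·m_i ≥ Rlev + 4` (face rows)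

builds on p205010 (kernel theorem, internal audit signed; external expert review pending) — nothing in this file uses p205010.
Status sentence (coordinator 2026-08-20T04:30Z): "θ(p_c) = 0 on ℤ^d, all d ≥ 2 — kernel-verified (Lean 4/Mathlib, standard axioms); internal adversarial
audit SIGNED 2026-08-20 04:29Z; external expert review pending."
Lane `prim-bschramm-*`, seat `prim-bschramm-stmt` (gen 12); helper file (`--supports stmt-CriticalPhenomena-4575 --as helper`); ledger HOME/prim-bschramm-stmt/NEG-PARAMS.md v0.7 (n1) (cells
`⟨Kcell, m⟩` under (R3), p3's ruling pending — this file is the pure arithmetic of `m`, consumed by whichever cell map is ruled in; with `m = 1` nothing here is needed).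
INPUTS: `TwoAxis.Para.modulus/detD` (p266166), `NegPrm.vβOf/Dof/Dof_pos` (p272834), the discharges `NegPrm.hL0_of_floors/hL1_of_floors` (p267342: `20K·(|800|·L̂_i)·s ≤ D` from `K s + 2 ≤ M` /
`4K s + 2 ≤ M` and the long-scale `EquilibriumAt(W)` facts), `NegPrm.modulus_vβOf_layer`.
* §1 `L0hat n h ℓ vα := |v_β| + |v_α|`, `L1hat n h := n + |h|`, **`mOf₀ K n h ℓ vα := D / (20K·(800·L0hat))`**, **`mOf₁ K n h ℓ vα := D / (20K·(800·L1hat))`** (`ℤ`, floor division);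
* §2 `mOf₀_nonneg/mOf₁_nonneg`, **`cL_le_D₀/₁`** (`(20K·m_i)·(|800|·L̂_i) ≤ D` — the `hL0/hL1` hypotheses of `lip_coarseSkel`-type lemmas at resolution `c_i`), **`le_mOf₁`** (`K s + 2 ≤ M ⊢ s ≤ m₁`),
  **`le_mOf₀`** (`4K s + 2 ≤ M ⊢ s ≤ m₀`), and the ledger instances `two_le_mOf` (`8K + 2 ≤ M ⊢ 2 ≤ m₀ ∧ 2 ≤ m₁`).
[cite: MartineauTassion2017, §4.1–4.3 (the cell lattice)] [cite: KozmaNitzan2024, §4 pp. 25–26 (the two-unit cells `r_i = K s_i`)]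
-/

namespace Summit.CriticalPhenomena.PercolationContinuityZ3.Theorems.Transplant

namespace Skelφ

namespace NegPrm

open Literature.Probability.LatticeModels TwoAxis.Para

/-! ## §1 The multipliers -/

/-- `L̂₀ := |v_β| + |v_α|` (the per-edge Lipschitz constant of `λ₀/800`). [this work] -/
def L0hat (n : ℕ) (h : ℤ) (ℓ : ℕ) (vα : ℤ) : ℤ := |vβOf n h ℓ vα| + |vα|

/-- `L̂₁ := n + |h|` (the per-edge Lipschitz constant of `λ₁/800`). [this work] -/
def L1hat (n : ℕ) (h : ℤ) : ℤ := (n : ℤ) + |h|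

/-- **The fine multiplier of axis 0**: `m₀ := ⌊D / (20K·800·L̂₀)⌋`. [this work] -/
def mOf₀ (K n : ℕ) (h : ℤ) (ℓ : ℕ) (vα : ℤ) : ℤ := Dof n h ℓ vα / (20 * (K : ℤ) * (800 * L0hat n h ℓ vα))

/-- **The fine multiplier of axis 1**: `m₁ := ⌊D / (20K·800·L̂₁)⌋`. [this work] -/
def mOf₁ (K n : ℕ) (h : ℤ) (ℓ : ℕ) (vα : ℤ) : ℤ := Dof n h ℓ vα / (20 * (K : ℤ) * (800 * L1hat n h))

/-- `0 ≤ L̂₀` and `0 ≤ L̂₁`. [folklore] -/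
theorem Lhat_nonneg (n : ℕ) (h : ℤ) (ℓ : ℕ) (vα : ℤ) : 0 ≤ L0hat n h ℓ vα ∧ 0 ≤ L1hat n h := ⟨by unfold L0hat; positivity, by unfold L1hat; positivity⟩

/-- `L̂₀` and `L̂₁` in the `|A|·(…)` shape of hp-8's lemmas (`A = 800`). [folklore] -/
theorem absA_mul_Lhat (n : ℕ) (h : ℤ) (ℓ : ℕ) (vα : ℤ) :
    |(800 : ℤ)| * (|vβOf n h ℓ vα| + |vα|) = 800 * L0hat n h ℓ vα ∧ |(800 : ℤ)| * (|(n : ℤ)| + |h|) = 800 * L1hat n h := by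
  rw [abs_of_nonneg (by norm_num : (0 : ℤ) ≤ 800), abs_of_nonneg (by positivity : (0 : ℤ) ≤ (n : ℤ))]
  exact ⟨rfl, rfl⟩

/-! ## §2 The facts -/

/-- `0 ≤ m₀` and `0 ≤ m₁` (`1 ≤ n`, `1 ≤ ℓ`: `D > 0`). [folklore] -/
theorem mOf_nonneg {K n ℓ : ℕ} (hn : 1 ≤ n) (hℓ : 1 ≤ ℓ) (h vα : ℤ) : 0 ≤ mOf₀ K n h ℓ vα ∧ 0 ≤ mOf₁ K n h ℓ vα := by
  have hD := (Dof_pos hn hℓ h vα).le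
  have h0 := (Lhat_nonneg n h ℓ vα).1
  have h1 := (Lhat_nonneg n h ℓ vα).2
  exact ⟨Int.ediv_nonneg hD (by positivity), Int.ediv_nonneg hD (by positivity)⟩

/-- **`c₀·L₀ ≤ D` by definition**: `(20K·m₀)·(|800|·(|v_β| + |v_α|)) ≤ D` (`1 ≤ n`, `1 ≤ ℓ`). [folklore] -/
theorem cL_le_D₀ {K n ℓ : ℕ} (hn : 1 ≤ n) (hℓ : 1 ≤ ℓ) (h vα : ℤ) :
    20 * (K : ℤ) * mOf₀ K n h ℓ vα * (|(800 : ℤ)| * (|vβOf n h ℓ vα| + |vα|)) ≤ Dof n h ℓ vα := by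
  rw [(absA_mul_Lhat n h ℓ vα).1]
  have hD := (Dof_pos hn hℓ h vα).le
  set X : ℤ := 20 * (K : ℤ) * (800 * L0hat n h ℓ vα) with hX
  rcases eq_or_ne X 0 with h0 | h0
  · have : 20 * (K : ℤ) * mOf₀ K n h ℓ vα * (800 * L0hat n h ℓ vα) = mOf₀ K n h ℓ vα * X := by rw [hX]; ring
    rw [this, h0, mul_zero]; exact hD
  · have e : 20 * (K : ℤ) * mOf₀ K n h ℓ vα * (800 * L0hat n h ℓ vα) = Dof n h ℓ vα / X * X := by rw [mOf₀, ← hX]; ring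
    rw [e]; exact Int.ediv_mul_le _ h0

/-- **`c₁·L₁ ≤ D` by definition**: `(20K·m₁)·(|800|·(|n| + |h|)) ≤ D` (`1 ≤ n`, `1 ≤ ℓ`). [folklore] -/
theorem cL_le_D₁ {K n ℓ : ℕ} (hn : 1 ≤ n) (hℓ : 1 ≤ ℓ) (h vα : ℤ) :
    20 * (K : ℤ) * mOf₁ K n h ℓ vα * (|(800 : ℤ)| * (|(n : ℤ)| + |h|)) ≤ Dof n h ℓ vα := by
  rw [(absA_mul_Lhat n h ℓ vα).2]
  have hD := (Dof_pos hn hℓ h vα).le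
  set X : ℤ := 20 * (K : ℤ) * (800 * L1hat n h) with hX
  rcases eq_or_ne X 0 with h0 | h0
  · have : 20 * (K : ℤ) * mOf₁ K n h ℓ vα * (800 * L1hat n h) = mOf₁ K n h ℓ vα * X := by rw [hX]; ring
    rw [this, h0, mul_zero]; exact hD
  · have e : 20 * (K : ℤ) * mOf₁ K n h ℓ vα * (800 * L1hat n h) = Dof n h ℓ vα / X * X := by rw [mOf₁, ← hX]; ring
    rw [e]; exact Int.ediv_mul_le _ h0

/-- **`s ≤ m₁` from the floor `K·s + 2 ≤ M`** and the long-scale `EquilibriumAt(W)` facts (`hL1_of_floors`: `20K·(800 L̂₁)·s ≤ D`; `1 ≤ K`). [this work] -/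
theorem le_mOf₁ {K : ℕ} (hK1 : 1 ≤ K) {s M : ℤ} {n ℓ : ℕ} {h : ℤ} (vα : ℤ) (hs : 0 ≤ s) (hM : (K : ℤ) * s + 2 ≤ M) (hn : M + 1 ≤ n) (hℓ : M + 1 ≤ ℓ)
    (hlay₁ : (M + 1) * ((n : ℤ) + |h|) ≤ (n : ℤ) * ((ℓ : ℤ) + 1)) : s ≤ mOf₁ K n h ℓ vα := by
  have hK : (0 : ℤ) ≤ K := by positivity
  have hn1 : 1 ≤ n := (one_le_of_floor (mul_nonneg hK hs) hM hn hℓ).1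
  have hL := hL1_of_floors hK hs hM hn hℓ hlay₁ (modulus_vβOf_layer hn1 h ℓ vα)
  rw [one_mul, (absA_mul_Lhat n h ℓ vα).2] at hL
  have hL1 : (1 : ℤ) ≤ L1hat n h := by
    have h1 := abs_nonneg h
    have h2 : (1 : ℤ) ≤ n := by exact_mod_cast hn1
    unfold L1hat; linarith
  have hK1' : (1 : ℤ) ≤ K := by exact_mod_cast hK1
  have hX : 0 < 20 * (K : ℤ) * (800 * L1hat n h) := by positivity
  unfold mOf₁
  refine Int.le_ediv_of_mul_le hX ?_
  have e : s * (20 * (K : ℤ) * (800 * L1hat n h)) = 20 * K * (800 * L1hat n h * s) := by ring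
  rw [e]; exact hL

/-- **`s ≤ m₀` from the floor `4K·s + 2 ≤ M`**, `|v_α| ≤ n` and the long-scale facts (`hL0_of_floors`: `20K·(800 L̂₀)·s ≤ D`; `1 ≤ K`). [this work] -/
theorem le_mOf₀ {K : ℕ} (hK1 : 1 ≤ K) {s M : ℤ} {n ℓ : ℕ} {h vα : ℤ} (hs : 0 ≤ s) (hM : 4 * (K : ℤ) * s + 2 ≤ M) (hn : M + 1 ≤ n) (hℓ : M + 1 ≤ ℓ)
    (hlay₁ : (M + 1) * ((n : ℤ) + |h|) ≤ (n : ℤ) * ((ℓ : ℤ) + 1)) (hv : |vα| ≤ (n : ℤ)) : s ≤ mOf₀ K n h ℓ vα := by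
  have hK : (0 : ℤ) ≤ K := by positivity
  have hn1 := one_le_of_floor (by positivity : (0 : ℤ) ≤ 4 * K * s) hM hn hℓ
  have hlay := modulus_vβOf_layer hn1.1 h ℓ vα
  have hL := hL0_of_floors hK hs hM hn hℓ hlay₁ hv hlay
  rw [one_mul, (absA_mul_Lhat n h ℓ vα).1] at hL
  -- `L̂₀ ≥ 1`: `(v_α, v_β) ≠ 0` since `modulus > 0`
  have hL0 : (1 : ℤ) ≤ L0hat n h ℓ vα := by
    have hpos := modulus_vβOf_pos hn1.1 hn1.2 h vα
    unfold L0hat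
    by_contra hc
    push Not at hc
    have ha : |vβOf n h ℓ vα| = 0 := by linarith [abs_nonneg (vβOf n h ℓ vα), abs_nonneg vα]
    have hb : |vα| = 0 := by linarith [abs_nonneg (vβOf n h ℓ vα), abs_nonneg vα]
    rw [abs_eq_zero] at ha hb
    unfold modulus at hpos
    rw [ha, hb] at hpos
    simp at hpos
  have hK1' : (1 : ℤ) ≤ K := by exact_mod_cast hK1
  have hX : 0 < 20 * (K : ℤ) * (800 * L0hat n h ℓ vα) := by positivity
  unfold mOf₀
  refine Int.le_ediv_of_mul_le hX ?_
  have e : s * (20 * (K : ℤ) * (800 * L0hat n h ℓ vα)) = 20 * K * (800 * L0hat n h ℓ vα * s) := by ring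
  rw [e]; exact hL

/-- **The ledger instances**: with `1 ≤ K` and `8K + 2 ≤ M` (below the floor `4K(R′+2) ≤ M_L`), both multipliers are `≥ 2` (hp-8 (R2): quasi-step exit frames need `m_I ≥ 2`);
with `4K·s + 2 ≤ M` both are `≥ s` (face rows: `10·m_I ≥ Rlev + 4` from `s := R′ + 1`). [this work] -/
theorem two_le_mOf {K : ℕ} (hK1 : 1 ≤ K) {M : ℤ} {n ℓ : ℕ} {h vα : ℤ} (hM : 8 * (K : ℤ) + 2 ≤ M) (hn : M + 1 ≤ n) (hℓ : M + 1 ≤ ℓ)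
    (hlay₁ : (M + 1) * ((n : ℤ) + |h|) ≤ (n : ℤ) * ((ℓ : ℤ) + 1)) (hv : |vα| ≤ (n : ℤ)) : 2 ≤ mOf₀ K n h ℓ vα ∧ 2 ≤ mOf₁ K n h ℓ vα :=
  ⟨le_mOf₀ hK1 (by norm_num) (by linarith) hn hℓ hlay₁ hv, le_mOf₁ hK1 vα (by norm_num) (by linarith) hn hℓ hlay₁⟩

/-- Both multipliers dominate any `s ≥ 0` with `4K·s + 2 ≤ M`. [folklore] -/
theorem le_mOf_both {K : ℕ} (hK1 : 1 ≤ K) {s M : ℤ} {n ℓ : ℕ} {h vα : ℤ} (hs : 0 ≤ s) (hM : 4 * (K : ℤ) * s + 2 ≤ M) (hn : M + 1 ≤ n) (hℓ : M + 1 ≤ ℓ)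
    (hlay₁ : (M + 1) * ((n : ℤ) + |h|) ≤ (n : ℤ) * ((ℓ : ℤ) + 1)) (hv : |vα| ≤ (n : ℤ)) : s ≤ mOf₀ K n h ℓ vα ∧ s ≤ mOf₁ K n h ℓ vα :=
  ⟨le_mOf₀ hK1 hs hM hn hℓ hlay₁ hv, le_mOf₁ hK1 vα hs (by nlinarith [mul_nonneg (by positivity : (0 : ℤ) ≤ K) hs]) hn hℓ hlay₁⟩

end NegPrm

end Skelφ

end Summit.CriticalPhenomena.PercolationContinuityZ3.Theorems.Transplant
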